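import Summits.Ventures.QEC.Census.RankRREF
import HarnessLib

/-!
# Masks-only RREF rank certificates: the PIVOT check split over index ranges (plumbing for large check matrices)

Companion to `Census/RankRREFAppend.lean`. The conjunct `pivotsOK n piv red` of `Census/RankRREF.lean` /
`Census/CertInfoSet.lean` checks, for every index `i < |piv|`, that the pivot column `piv[i]` of the reduced rows `red` is the
unit vector `e_i` (`colMask red piv[i] = 2^i`). At `|piv| = 380` over 784-bit reduced rows (the `[[784,24,≤24]]` code,
`Census/BB/BB784Data.lean`) this single Boolean costs ≈ 410 s of kernel time (qec-search-2 g4 farm probe, 2026-08-27) —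
too close to the gate's file budget. The two lemmas below let a consumer prove the same fact from CHUNKS over index ranges
`List.range' s len`, each a separate `decide +kernel`:

* `forall_of_all_range'` — read a chunk fact `(List.range' s len).all F = true` as `∀ i, s ≤ i → i < s + len → F i = true`;
* `pivotsOK_of_forall` — `pivotsOK n piv red = true` from `|piv| = |red|` and the pointwise facts for all `i < |piv|`.

Everything PROVED; no definitions; axioms standard. HONEST FRAMING: plumbing only — certifies nothing by itself.
-/

namespace Summit.Ventures.QEC.Census

/-- A chunk fact over `List.range' s len` read pointwise. -/
theorem forall_of_all_range' {F : ℕ → Bool} {s len : ℕ} (h : (List.range' s len).all F = true) :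
    ∀ i, s ≤ i → i < s + len → F i = true :=
  fun i h1 h2 => List.all_eq_true.1 h i (List.mem_range'_1.2 ⟨h1, h2⟩)

/-- **`pivotsOK` from pointwise facts**: equal lengths and, for every `i < |piv|`, pivot `piv[i] < n` with unit pivot column
`colMask red piv[i] = 2^i`. -/
theorem pivotsOK_of_forall {n : ℕ} {piv red : List ℕ} (hlen : piv.length = red.length)
    (h : ∀ i, i < piv.length → ((piv.getD i 0 < n : Bool) && (colMask red (piv.getD i 0) == 2 ^ i)) = true) :
    pivotsOK n piv red = true := by
  unfold pivotsOK
  rw [Bool.and_eq_true]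
  refine ⟨by rw [hlen]; exact beq_self_eq_true _, List.all_eq_true.2 fun i hi => h i (List.mem_range.1 hi)⟩

/-- CONTROL: the `3 × 4` example of `RankRREF.lean` (`piv = [0, 1]`, `red = [5, 6]`) with its pivot check assembled from two
one-index chunks. -/
theorem pivotsOK_control3_chunked : pivotsOK 4 [0, 1] [5, 6] = true := by
  have c1 : ((List.range' 0 1).all fun i =>
      ((([0, 1] : List ℕ).getD i 0 < 4 : Bool) && (colMask [5, 6] (([0, 1] : List ℕ).getD i 0) == 2 ^ i))) = true := by
    decide
  have c2 : ((List.range' 1 1).all fun i =>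
      ((([0, 1] : List ℕ).getD i 0 < 4 : Bool) && (colMask [5, 6] (([0, 1] : List ℕ).getD i 0) == 2 ^ i))) = true := by
    decide
  exact pivotsOK_of_forall rfl fun i hi => by
    rcases Nat.lt_or_ge i 1 with h1 | h1
    · exact forall_of_all_range' c1 i (Nat.zero_le _) (by omega)
    · exact forall_of_all_range' c2 i h1 (by simp at hi; omega)

end Summit.Ventures.QEC.Census
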